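import Summits.CriticalPhenomena.PercolationContinuityZ3.Theorems.FK.IsingStateFKG
import Summits.CriticalPhenomena.PercolationContinuityZ3.Theorems.FK.NewmanCLT
import Literature.Probability.LatticeModels.SusceptibilityMeanFieldBound
import Literature.Probability.LatticeModels.CriticalCorrWellDefined
import HarnessLib

/-!
# NEWMAN'S CENTRAL LIMIT THEOREM FOR THE MAGNETISATION OF THE ISING MODEL:
# `|Λ_n|^{-1/2} Σ_{x∈Λ_n} σ_x ⇒ N(0, χ(β))` IN THE FREE STATE FOR `0 ≤ β < β_c(d)`, `d ≥ 2`, WITH `χ(β) = Σ_x ⟨σ_0σ_x⟩^∅_β ≥ 1`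

Claimed R42 (8)(c) in the cell INBOX at 2026-08-28T18:06:48Z by fkp-10a gen 355 (NEW CLAIM #1 of the gen), addressed to coordinator fk-4 (next seated gen; none seated since gen 275's closing line l.8493, (ι) in force for windows); lineage row FO-10a-g355 (self-suggested), package g355-isingclt, label IM-B.
Helper file of the `fk-continuity` build cell (bschramm lane; `--supports stmt-CriticalPhenomena-4575`); builds on
p205010 (kernel theorem, internal audit signed; external expert review pending). No definitions, no named facts, no
sorries; standard axioms. UNCONDITIONAL.

Newman 1980 (Comm. Math. Phys. 74), §1: "the most obvious example is the Ising ferromagnet … Theorem 2 yields a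
central limit theorem for the block magnetisations whenever the susceptibility is finite". This file is that
application, with every hypothesis a tree theorem:

* (A) FKG of the infinite-volume state — `IsingStateFKG` (`isPositivelyAssociated_of_spinCorr_eq_freeCorr`);
* (B) translation invariance — `isTranslationInvariantMeasure_of_spinCorr_eq_freeCorr` (Friedli–Velenik Ex. 3.16),
  transported to covariances (`covariance_spinAt_eq_of_isTranslationInvariant`);
* (D) finite susceptibility below `β_c` — SHARPNESS (Aizenman–Barsky–Fernández 1987 Thm. 1 / Duminil-Copin–Tassion
  2016 Thm. 1.2, the tree's PROVED `twoPoint_exponentialDecay_of_lt_criticalBeta_holds`): `Σ_x ⟨σ_0σ_x⟩^∅_β < ∞`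
  (`summable_twoPointFree_of_lt_criticalBeta`), and `⟨σ_x⟩^∅_{β,0} = 0` (`freeCorr_eq_zero_of_odd_card`);
* the CLT itself — the tree's generic `NewmanCLT.tendstoInDistribution_boxSum` (Newman's Thm. 2 for bounded increasing
  fields over a positively associated measure with summable translation-covariant covariances).

Main statements (`μ` = the free state: the probability measure on `{−1,+1}^{ℤ^d}` with `∫ σ_A dμ = freeCorr d β 0 A`,
which exists and is unique — `exists_freeMeasure_holds`, `measure_eq_of_forall_spinCorr_eq`):

* `tendstoInDistribution_boxSpinSum_of_summable` — GENERIC: for ANY positively associated translation-invariant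
  probability measure on `{−1,+1}^{ℤ^d}` (`d ≥ 1`) with summable truncated two-point function
  `γ(z) = Cov(σ_0, σ_z)`: `(M_n − E M_n)/√|Λ_n| ⇒ N(0, Σ_z γ(z))`, `M_n = Σ_{x∈Λ_n} σ_x`
  (plus and minus states included — companion file `IsingPlusStateCLT`).
* `covariance_spinAt_eq_twoPointFree`, `integral_boxSpinSum_eq_zero` — in the free state at `h = 0`:
  `Cov(σ_x, σ_y) = ⟨σ_0σ_{y−x}⟩^∅_β` and `E M_n = 0`.
* `summable_twoPointFree_of_lt_criticalBeta`, `tsum_twoPointFree_eq_toReal_susceptibility`, `one_le_tsum_twoPointFree`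
  (Griffiths' `⟨σ_0σ_x⟩ ≥ 0` is the tree's `twoPointFree_nonneg`) — `χ(β) = Σ_x⟨σ_0σ_x⟩^∅_β = (susceptibility d β).toReal ∈ [1, ∞)` for `β < β_c`.
* **`tendsto_charFun_magnetization_of_lt_criticalBeta`**, **`tendstoInDistribution_magnetization_of_lt_criticalBeta`** —
  for `d ≥ 2`, `0 ≤ β < β_c(d)`: `E^∅_β exp(it M_n/√|Λ_n|) → exp(−χ(β)t²/2)` and `M_n/√|Λ_n| ⇒ N(0, χ(β))`
  (Mathlib `TendstoInDistribution` to `gaussianReal 0 χ(β)`), NON-DEGENERATE (`χ ≥ 1`).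
* `exists_freeState_tendstoInDistribution_magnetization` — the same with the free state produced by
  `exists_freeMeasure_holds` (non-vacuity of the hypothesis `∀ A, ∫ σ_A dμ = freeCorr d β 0 A`).

## References

* C. M. Newman, *Normal fluctuations and the FKG inequalities*, Comm. Math. Phys. 74 (1980) 119–128, Thm. 2 and §1
  (the Ising application). [Newman1980]
* R. S. Ellis, *Entropy, Large Deviations, and Statistical Mechanics*, Springer 2006 (Grundlehren 271, 1985), §V.7,
  Lemma V.7.1 and Thm. V.7.2 (the CLT for `S_Λ` under finite susceptibility, proof after Newman). [Ellis2006]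
* M. Aizenman, D. Barsky, R. Fernández, J. Stat. Phys. 47 (1987) 343–374, Thm. 1; H. Duminil-Copin, V. Tassion,
  Comm. Math. Phys. 343 (2016) 725–745, Thm. 1.2 (finite susceptibility below `β_c`). [AizenmanBarskyFernandezJSP1987]
* S. Friedli, Y. Velenik, *Statistical Mechanics of Lattice Systems*, CUP 2017, Thm. 3.17, Thm. 3.21, Ex. 3.16,
  §3.7.4 (susceptibility). [FriedliVelenik2017]
-/

noncomputable section

namespace Summit.CriticalPhenomena.PercolationContinuityZ3.Theorems.FK

namespace IsingCLT

open MeasureTheory ProbabilityTheory Filter Topology Finset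
open Literature.Probability.Percolation Literature.Probability.LatticeModels
open Summit.CriticalPhenomena.PercolationContinuityZ3.Theorems.FK.NewmanCLT

variable {d : ℕ}

/-! ### The spin field as a Newman field: bounded, increasing, translation covariant -/

/-- `|σ_x| ≤ 1`. [folklore] -/
theorem abs_spinAt_le_one (x : Site d) (σ : SpinConfig (Site d)) : |spinAt x σ| ≤ (1 : ℝ) :=
  (abs_spinAt x σ).le

/-- The spin field is in every `L^p` of a probability measure. [folklore] -/
theorem memLp_spinAt (μ : Measure (SpinConfig (Site d))) [IsProbabilityMeasure μ] (x : Site d) (p : ENNReal) :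
    MemLp (spinAt x) p μ :=
  memLp_of_abs_le (measurable_spinAt x) (abs_spinAt_le_one x) p

/-- Translating a configuration translates the spin field: `σ_x(θ_v σ) = σ_{x−v}(σ)`.
[cite: FriedliVelenik2017, Thm. 3.17 (2)] -/
theorem spinAt_configShift (v x : Site d) (σ : SpinConfig (Site d)) :
    spinAt x (configShift v σ) = spinAt (x - v) σ := by
  simp [spinAt, configShift_apply]

/-- **(B) Translation covariance of the spin covariances**: for a translation-invariant probability measure on
`{−1,+1}^{ℤ^d}`, `Cov(σ_x, σ_y) = Cov(σ_0, σ_{y−x})`. [cite: Newman1980, Thm. 2 (B); FriedliVelenik2017, Thm. 3.17 (2)] -/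
theorem covariance_spinAt_eq_of_isTranslationInvariant {μ : Measure (SpinConfig (Site d))}
    (hμ : IsTranslationInvariantMeasure μ) (x y : Site d) :
    cov[spinAt x, spinAt y; μ] = cov[spinAt 0, spinAt (y - x); μ] := by
  conv_lhs => rw [← hμ x]
  rw [covariance_map_equiv]
  have h1 : spinAt x ∘ (configShift (S := ℤˣ) x) = spinAt (0 : Site d) := by
    funext σ; rw [Function.comp_apply, spinAt_configShift, sub_self]
  have h2 : spinAt y ∘ (configShift (S := ℤˣ) x) = spinAt (y - x) := by
    funext σ; rw [Function.comp_apply, spinAt_configShift]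
  rw [h1, h2]

/-! ### The generic magnetisation CLT for FKG translation-invariant spin measures -/

/-- **NEWMAN'S CLT FOR THE MAGNETISATION, characteristic-function form, generic** (Newman 1980, Thm. 2 for the
spin field): let `μ` be a positively associated, translation-invariant probability measure on `{−1,+1}^{ℤ^d}`
(`d ≥ 1`) whose truncated two-point function `γ(z) = Cov_μ(σ_0, σ_z)` is summable. Then with
`M_n = Σ_{x∈Λ_n} σ_x`: `E_μ exp(it(M_n − E M_n)/√|Λ_n|) → exp(−(Σ_z γ(z)) t²/2)`.
[cite: Newman1980, Thm. 2] -/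
theorem tendsto_charFun_boxSpinSum_of_summable {μ : Measure (SpinConfig (Site d))} [IsProbabilityMeasure μ]
    (hd : 1 ≤ d) (hPA : IsPositivelyAssociated μ) (hT : IsTranslationInvariantMeasure μ)
    (hsum : Summable fun z : Site d => cov[spinAt 0, spinAt z; μ]) (t : ℝ) :
    Tendsto (fun n : ℕ => ∫ σ, Complex.exp ((((t / Real.sqrt #(box d n)) *
        (∑ z ∈ box d n, spinAt z σ - ∫ σ', ∑ z ∈ box d n, spinAt z σ' ∂μ) : ℝ) : ℂ) * Complex.I) ∂μ)
      atTop (𝓝 ((Real.exp (-((∑' z : Site d, cov[spinAt 0, spinAt z; μ]) * t ^ 2 / 2)) : ℝ) : ℂ)) :=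
  tendsto_charFun_boxSum hd hPA measurable_spinAt spinAt_mono zero_le_one abs_spinAt_le_one
    (fun x y => covariance_spinAt_eq_of_isTranslationInvariant hT x y) hsum t

/-- **NEWMAN'S CLT FOR THE MAGNETISATION, generic** (Newman 1980, Thm. 2 for the spin field): under the hypotheses
of `tendsto_charFun_boxSpinSum_of_summable`, `(M_n − E_μ M_n)/√|Λ_n| → N(0, σ²)` in distribution,
`σ² = Σ_z Cov_μ(σ_0, σ_z)` (any `Y` with law `gaussianReal 0 σ²`). Applies verbatim to the free, plus and minus
Ising states whenever their susceptibility is finite (Ellis 2006, Thm. V.7.2 (a): `(S_Λ − |Λ| m)/√|Λ| ⇒ N(0, σ²)` if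
`σ² = Σ_k ⟨Y_0; Y_k⟩ < ∞`; Lemma V.7.1: `σ²` is that series). [cite: Newman1980, Thm. 2; Ellis2006, Thm. V.7.2 and Lemma V.7.1] -/
theorem tendstoInDistribution_boxSpinSum_of_summable {Ω' : Type*} {mΩ' : MeasurableSpace Ω'} {P' : Measure Ω'}
    [IsProbabilityMeasure P'] {Y : Ω' → ℝ} {μ : Measure (SpinConfig (Site d))} [IsProbabilityMeasure μ]
    (hd : 1 ≤ d) (hPA : IsPositivelyAssociated μ) (hT : IsTranslationInvariantMeasure μ)
    (hsum : Summable fun z : Site d => cov[spinAt 0, spinAt z; μ]) {v : NNReal}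
    (hv : (v : ℝ) = ∑' z : Site d, cov[spinAt 0, spinAt z; μ]) (hY : HasLaw Y (gaussianReal 0 v) P') :
    TendstoInDistribution (fun (n : ℕ) (σ : SpinConfig (Site d)) => (Real.sqrt #(box d n))⁻¹ *
        (∑ z ∈ box d n, spinAt z σ - ∫ σ', ∑ z ∈ box d n, spinAt z σ' ∂μ)) atTop Y (fun _ => μ) P' :=
  tendstoInDistribution_boxSum hd hPA measurable_spinAt spinAt_mono zero_le_one abs_spinAt_le_one
    (fun x y => covariance_spinAt_eq_of_isTranslationInvariant hT x y) hsum hv hY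

/-! ### The free state at `h = 0`: mean zero, covariances = the free two-point function -/

section Free

variable {β : ℝ} {μ : Measure (SpinConfig (Site d))} [IsProbabilityMeasure μ]

omit [IsProbabilityMeasure μ] in
/-- **`⟨σ_x⟩^∅_{β,0} = 0`**: in the free state at zero field every spin has mean zero (odd correlations vanish,
Friedli–Velenik 2017, eq. (3.33)). [cite: FriedliVelenik2017, §3.7.1, eq. (3.33)] -/
theorem integral_spinAt_eq_zero (hβ : 0 ≤ β) (hμ : ∀ A : Finset (Site d), spinCorr μ A = freeCorr d β 0 A)
    (x : Site d) : ∫ σ, spinAt x σ ∂μ = 0 := by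
  have h := hμ {x}
  rw [spinCorr, spinProduct_singleton] at h
  rw [h]
  exact freeCorr_eq_zero_of_odd_card hβ (by simp)

/-- **`E^∅_β M_n = 0`**: the box magnetisation has mean zero in the free state at `h = 0`.
[cite: FriedliVelenik2017, §3.7.1, eq. (3.33)] -/
theorem integral_boxSpinSum_eq_zero (hβ : 0 ≤ β) (hμ : ∀ A : Finset (Site d), spinCorr μ A = freeCorr d β 0 A)
    (n : ℕ) : ∫ σ, ∑ z ∈ box d n, spinAt z σ ∂μ = 0 := by
  rw [integral_finsetSum _ fun z _ => integrable_of_abs_le (measurable_spinAt z) (abs_spinAt_le_one z)]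
  exact Finset.sum_eq_zero fun z _ => integral_spinAt_eq_zero hβ hμ z

/-- **`∫ σ_0 σ_z dμ = ⟨σ_0σ_z⟩^∅_β`** for the free state `μ` at `h = 0` (`σ_0σ_z = σ_{{0,z}}` for `z ≠ 0`, `= 1` for
`z = 0`). [cite: FriedliVelenik2017, §3.7.4] -/
theorem integral_spinAt_mul_spinAt_eq_twoPointFree (hμ : ∀ A : Finset (Site d), spinCorr μ A = freeCorr d β 0 A)
    (z : Site d) : ∫ σ, spinAt 0 σ * spinAt z σ ∂μ = twoPointFree d β z := by
  classical
  rcases eq_or_ne (0 : Site d) z with rfl | hz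
  · simp only [spinAt_mul_self, integral_const, probReal_univ, smul_eq_mul, mul_one]
    exact (twoPointFree_zero (d := d) (β := β)).symm
  · have h1 : (fun σ => spinAt (0 : Site d) σ * spinAt z σ) = spinProduct ({0, z} : Finset (Site d)) := by
      funext σ; rw [← spinPair_eq_spinProduct hz]; rfl
    rw [h1]
    change spinCorr μ {0, z} = _
    rw [hμ, twoPointFree, freeCorr, spinPair_eq_spinProduct hz]

/-- **`Cov^∅_β(σ_x, σ_y) = ⟨σ_0σ_{y−x}⟩^∅_β`**: in the free state at `h = 0` (`β ≥ 0`) the spin covariances ARE the free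
two-point function (mean zero + translation invariance). [cite: Newman1980, Thm. 2 (B); FriedliVelenik2017, Ex. 3.16 and §3.7.4] -/
theorem covariance_spinAt_eq_twoPointFree (hβ : 0 ≤ β) (hμ : ∀ A : Finset (Site d), spinCorr μ A = freeCorr d β 0 A)
    (x y : Site d) : cov[spinAt x, spinAt y; μ] = twoPointFree d β (y - x) := by
  rw [covariance_spinAt_eq_of_isTranslationInvariant
    (isTranslationInvariantMeasure_of_spinCorr_eq_freeCorr hβ le_rfl μ hμ) x y,
    covariance_eq_sub (memLp_spinAt μ 0 2) (memLp_spinAt μ (y - x) 2)]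
  simp only [Pi.mul_apply, integral_spinAt_eq_zero hβ hμ, mul_zero, sub_zero]
  exact integral_spinAt_mul_spinAt_eq_twoPointFree hμ (y - x)

end Free

/-! ### (D) Finite susceptibility below `β_c`: `χ(β) = Σ_x ⟨σ_0σ_x⟩^∅_β ∈ [1, ∞)` -/

/-- **Finite susceptibility below `β_c`** (Aizenman–Barsky–Fernández 1987, Thm. 1; Duminil-Copin–Tassion 2016,
Thm. 1.2 — the tree's proved sharpness `twoPoint_exponentialDecay_of_lt_criticalBeta_holds`): for `d ≥ 2` and
`0 ≤ β < β_c(d)`, `x ↦ ⟨σ_0σ_x⟩^∅_β` is summable over `ℤ^d` (`0 ≤ ⟨σ_0σ_x⟩ ≤ e^{−c‖x‖}` and the box sums of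
`e^{−c‖x‖}` are bounded, `sum_box_exp_neg_mul_norm_le`). [cite: AizenmanBarskyFernandezJSP1987, Thm. 1; DuminilCopinTassionCMP2016, Thm. 1.2] -/
theorem summable_twoPointFree_of_lt_criticalBeta (hd : 2 ≤ d) {β : ℝ} (hβ : 0 ≤ β) (hβc : β < criticalBeta d) :
    Summable (twoPointFree d β) := by
  obtain ⟨c, hc, hdec⟩ := twoPoint_exponentialDecay_of_lt_criticalBeta_holds (d := d) hd hβ hβc
  obtain ⟨B, hB⟩ := sum_box_exp_neg_mul_norm_le (d := d) hc
  have h0 : ∀ x : Site d, 0 ≤ twoPointFree d β x := fun x =>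
    twoPointFree_nonneg hasBoxLimit_isingCorr_free_holds (fun {_ _ _ _ _} => GKSInequalities.gks_one_holds (zdGraph d)) hβ x
  refine summable_of_sum_le (c := B) h0 fun s => ?_
  obtain ⟨N, hN⟩ := exists_forall_subset_box d s
  refine (Finset.sum_le_sum_of_subset_of_nonneg (hN N le_rfl) fun x _ _ => h0 x).trans ?_
  exact (Finset.sum_le_sum fun x _ => hdec x).trans (hB N)

/-- **`χ(β) = Σ_x ⟨σ_0σ_x⟩^∅_β`**: when the free two-point function is summable, the tree's `ℝ≥0∞`-valued
`susceptibility d β` is the real series. [cite: FriedliVelenik2017, §3.7.4] -/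
theorem tsum_twoPointFree_eq_toReal_susceptibility {β : ℝ} (hβ : 0 ≤ β) (hs : Summable (twoPointFree d β)) :
    ∑' x : Site d, twoPointFree d β x = (susceptibility d β).toReal := by
  have h0 : ∀ x : Site d, 0 ≤ twoPointFree d β x := fun x =>
    twoPointFree_nonneg hasBoxLimit_isingCorr_free_holds (fun {_ _ _ _ _} => GKSInequalities.gks_one_holds (zdGraph d)) hβ x
  rw [susceptibility, ← ENNReal.ofReal_tsum_of_nonneg h0 hs, ENNReal.toReal_ofReal (tsum_nonneg h0)]

/-- **`χ(β) ≥ 1`**: the susceptibility series dominates its diagonal term `⟨σ_0σ_0⟩ = 1` (all terms `≥ 0` by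
Griffiths). [cite: FriedliVelenik2017, §3.7.4] -/
theorem one_le_tsum_twoPointFree {β : ℝ} (hβ : 0 ≤ β) (hs : Summable (twoPointFree d β)) :
    1 ≤ ∑' x : Site d, twoPointFree d β x := by
  have h0 : ∀ x : Site d, 0 ≤ twoPointFree d β x := fun x =>
    twoPointFree_nonneg hasBoxLimit_isingCorr_free_holds (fun {_ _ _ _ _} => GKSInequalities.gks_one_holds (zdGraph d)) hβ x
  rw [← twoPointFree_zero (d := d) (β := β)]
  exact hs.le_tsum 0 fun x _ => h0 x

/-- `(susceptibility d β).toNNReal` is the real series, as an `ℝ≥0`. [cite: FriedliVelenik2017, §3.7.4] -/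
theorem coe_toNNReal_susceptibility {β : ℝ} (hβ : 0 ≤ β) (hs : Summable (twoPointFree d β)) :
    (((susceptibility d β).toNNReal : NNReal) : ℝ) = ∑' x : Site d, twoPointFree d β x := by
  rw [tsum_twoPointFree_eq_toReal_susceptibility hβ hs]
  rfl

/-! ### THE CENTRAL LIMIT THEOREM FOR THE MAGNETISATION BELOW `β_c` -/

/-- **CLT FOR THE ISING MAGNETISATION BELOW `β_c`, characteristic-function form** (Newman 1980, Thm. 2 + §1, with
sharpness): for `d ≥ 2`, `0 ≤ β < β_c(d)` and the free state `μ` (`∫ σ_A dμ = ⟨σ_A⟩^∅_{β,0}` for all finite `A`),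
with `M_n = Σ_{x∈Λ_n} σ_x`, `Λ_n = [−n,n]^d`: for every real `t`,
`∫ exp(it M_n/√|Λ_n|) dμ → exp(−χ(β) t²/2)`, `χ(β) = Σ_{x∈ℤ^d} ⟨σ_0σ_x⟩^∅_β`.
[cite: Newman1980, Thm. 2; AizenmanBarskyFernandezJSP1987, Thm. 1] -/
theorem tendsto_charFun_magnetization_of_lt_criticalBeta (hd : 2 ≤ d) {β : ℝ} (hβ : 0 ≤ β)
    (hβc : β < criticalBeta d) (μ : Measure (SpinConfig (Site d))) [IsProbabilityMeasure μ]
    (hμ : ∀ A : Finset (Site d), spinCorr μ A = freeCorr d β 0 A) (t : ℝ) :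
    Tendsto (fun n : ℕ => ∫ σ, Complex.exp ((((t / Real.sqrt #(box d n)) *
        (∑ z ∈ box d n, spinAt z σ) : ℝ) : ℂ) * Complex.I) ∂μ)
      atTop (𝓝 ((Real.exp (-((∑' x : Site d, twoPointFree d β x) * t ^ 2 / 2)) : ℝ) : ℂ)) := by
  have hcov : ∀ x y : Site d, cov[spinAt x, spinAt y; μ] = twoPointFree d β (y - x) :=
    covariance_spinAt_eq_twoPointFree hβ hμ
  have h := tendsto_charFun_boxSum (le_trans one_le_two hd) (isPositivelyAssociated_of_spinCorr_eq_freeCorr hβ le_rfl μ hμ)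
    measurable_spinAt spinAt_mono zero_le_one abs_spinAt_le_one hcov
    (summable_twoPointFree_of_lt_criticalBeta hd hβ hβc) t
  simp only [integral_boxSpinSum_eq_zero hβ hμ, sub_zero] at h
  exact h

/-- **CENTRAL LIMIT THEOREM FOR THE MAGNETISATION OF THE ISING MODEL BELOW `β_c`** (Newman 1980, Thm. 2 and §1;
finite susceptibility by Aizenman–Barsky–Fernández 1987 / Duminil-Copin–Tassion 2016): for `d ≥ 2`,
`0 ≤ β < β_c(d)` and the free infinite-volume state `μ` at zero field (the probability measure on `{−1,+1}^{ℤ^d}`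
with `∫ σ_A dμ = ⟨σ_A⟩^∅_{β,0}`, `exists_freeMeasure_holds` / `measure_eq_of_forall_spinCorr_eq`), the block
magnetisation `M_n = Σ_{x∈Λ_n} σ_x` satisfies

`M_n / √|Λ_n| → N(0, χ(β))` in distribution, `χ(β) = Σ_{x∈ℤ^d} ⟨σ_0σ_x⟩^∅_β = susceptibility d β ∈ [1, ∞)`

— Mathlib's `TendstoInDistribution`, the limit law being `gaussianReal 0 (susceptibility d β).toNNReal`
(non-degenerate: `one_le_tsum_twoPointFree`), for any random variable `Y` with that law. This is Ellis 2006, Thm. V.7.2 (a)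
for the nearest-neighbour model at `(β, 0)`, `β < β_c`, with its hypothesis `σ²(β,0) < ∞` discharged by sharpness.
[cite: Newman1980, Thm. 2; Ellis2006, Thm. V.7.2; AizenmanBarskyFernandezJSP1987, Thm. 1; DuminilCopinTassionCMP2016, Thm. 1.2] -/
theorem tendstoInDistribution_magnetization_of_lt_criticalBeta {Ω' : Type*} {mΩ' : MeasurableSpace Ω'}
    {P' : Measure Ω'} [IsProbabilityMeasure P'] {Y : Ω' → ℝ} (hd : 2 ≤ d) {β : ℝ} (hβ : 0 ≤ β)
    (hβc : β < criticalBeta d) (μ : Measure (SpinConfig (Site d))) [IsProbabilityMeasure μ]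
    (hμ : ∀ A : Finset (Site d), spinCorr μ A = freeCorr d β 0 A)
    (hY : HasLaw Y (gaussianReal 0 (susceptibility d β).toNNReal) P') :
    TendstoInDistribution (fun (n : ℕ) (σ : SpinConfig (Site d)) =>
        (Real.sqrt #(box d n))⁻¹ * ∑ z ∈ box d n, spinAt z σ) atTop Y (fun _ => μ) P' := by
  have hcov : ∀ x y : Site d, cov[spinAt x, spinAt y; μ] = twoPointFree d β (y - x) :=
    covariance_spinAt_eq_twoPointFree hβ hμ
  have hs := summable_twoPointFree_of_lt_criticalBeta hd hβ hβc
  have h := tendstoInDistribution_boxSum (le_trans one_le_two hd)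
    (isPositivelyAssociated_of_spinCorr_eq_freeCorr hβ le_rfl μ hμ) measurable_spinAt spinAt_mono zero_le_one
    abs_spinAt_le_one hcov hs (coe_toNNReal_susceptibility hβ hs) hY
  simp only [integral_boxSpinSum_eq_zero hβ hμ, sub_zero] at h
  exact h

/-- **The variance of the limit is the susceptibility and is at least `1`** (non-degeneracy of the magnetisation
CLT below `β_c`). [cite: Newman1980, (13); FriedliVelenik2017, §3.7.4] -/
theorem one_le_toReal_susceptibility_of_lt_criticalBeta (hd : 2 ≤ d) {β : ℝ} (hβ : 0 ≤ β)
    (hβc : β < criticalBeta d) : 1 ≤ (susceptibility d β).toReal := by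
  rw [← tsum_twoPointFree_eq_toReal_susceptibility hβ (summable_twoPointFree_of_lt_criticalBeta hd hβ hβc)]
  exact one_le_tsum_twoPointFree hβ (summable_twoPointFree_of_lt_criticalBeta hd hβ hβc)

/-- **THE MAGNETISATION CLT BELOW `β_c`, with the free state supplied** (non-vacuity of the hypothesis
`∀ A, ∫ σ_A dμ = ⟨σ_A⟩^∅_{β,0}`): for `d ≥ 2`, `0 ≤ β < β_c(d)` there is a translation-invariant Ising Gibbs
measure `μ ∈ 𝒢(β, 0)` with the free correlations under which `M_n/√|Λ_n| ⇒ N(0, χ(β))`.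
[cite: Newman1980, Thm. 2; FriedliVelenik2017, Ex. 3.16 and Thm. 6.26] -/
theorem exists_freeState_tendstoInDistribution_magnetization {Ω' : Type*} {mΩ' : MeasurableSpace Ω'}
    {P' : Measure Ω'} [IsProbabilityMeasure P'] {Y : Ω' → ℝ} (hd : 2 ≤ d) {β : ℝ} (hβ : 0 ≤ β)
    (hβc : β < criticalBeta d) (hY : HasLaw Y (gaussianReal 0 (susceptibility d β).toNNReal) P') :
    ∃ (μ : Measure (SpinConfig (Site d))) (_ : IsProbabilityMeasure μ), μ ∈ isingGibbsMeasures d β 0 ∧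
      IsTranslationInvariantMeasure μ ∧ (∀ A : Finset (Site d), spinCorr μ A = freeCorr d β 0 A) ∧
      TendstoInDistribution (fun (n : ℕ) (σ : SpinConfig (Site d)) =>
        (Real.sqrt #(box d n))⁻¹ * ∑ z ∈ box d n, spinAt z σ) atTop Y (fun _ => μ) P' := by
  obtain ⟨μ, hμG, hμT, hμc⟩ := exists_freeMeasure_holds d (β := β) 0 hβ le_rfl
  haveI : IsProbabilityMeasure μ := ((mem_isingGibbsMeasures_iff d β 0 μ).1 hμG).isProbabilityMeasure
  exact ⟨μ, inferInstance, hμG, hμT, hμc, tendstoInDistribution_magnetization_of_lt_criticalBeta hd hβ hβc μ hμc hY⟩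

end IsingCLT

end Summit.CriticalPhenomena.PercolationContinuityZ3.Theorems.FK

end
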